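import Mathlib.Combinatorics.SetFamily.KruskalKatona
import Summits.CriticalPhenomena.PercolationContinuityZ3.Theorems.PercNearOneGluingNoHeavyLowerTailAntiBandShift
import Summits.CriticalPhenomena.PercolationContinuityZ3.Theorems.PercNearOneGluingNoHeavyLowerTailAntiBandDetCriterion

/-!
# `NoHeavyLowerTail` (crux stmt-CriticalPhenomena-4575), lane prim-ineq-gen-4 (gen 21): the anti-band inequality (AB_l) on `Fin n` for ALL pairs of up-sets
# from the determinant criterion on LEFT-SHIFTED up-sets only

Support file (`--supports stmt-CriticalPhenomena-4575`; memo `run/shared/lean/prim/prim-ineq-gen-4/FINDING-DET-CRITERION-g21.md` §1 (vi)).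
No definitions, no `sorry`, standard axioms.

Gen 20's Lemma 1 (`AntiBandShift.antiBand_compression_swap_le`): compressing `A` along `(i ← j)` and `B` along `(j ← i)` does not increase the anti-band functional
`F(A,B) = #{outer members of A ∩ B} − #{outer members of A ∩ Bᶜˢ}`.  Iterating (the Kruskal–Katona measure `Σ_{s∈A} Σ_{a∈s} 2^a` strictly drops at each genuine
left shift, and single-element compressions keep upper sets upper) reduces (AB_l) for every pair of upper sets to (AB_l) for LEFT-SHIFTED `A` (compressed along every
`{i},{j}`, `i < j`) and arbitrary upper `B`, where gen 21's determinant criterion (`AntiBandDetCriterion.antiBand_of_det_binomial_ne_zero`) applies.  Main statement: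
`antiBand_of_forall_shifted_det_ne_zero` — if `det [C(n−1−#(x∪x'), l−1)]_{x,x' ∈ A, #x<l} ≠ 0` for every left-shifted upper set `A ⊆ 2^{Fin n}` (`2l ≤ n`), then (AB_l)
holds on `Fin n` for every pair of upper sets.  (The hypothesis is what tools-g21/c/abdet.c certifies for a given `(n,l)`; conjecture (M') of the memo asserts it always.)
-/

namespace Summit.CriticalPhenomena.PercolationContinuityZ3.Theorems.AntiBandShiftReduction

open Finset Finset.Colex
open scoped FinsetFamily

variable {n : ℕ}

/-- Compressing a family of finsets along two distinct SINGLETONS `{i}, {j}` (replace `j` by `i` when possible and new) keeps an upper set upper. [folklore] -/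
theorem isUpperSet_compression_singleton {α : Type*} [DecidableEq α] {i j : α} (hij : i ≠ j)
    {A : Finset (Finset α)} (hA : IsUpperSet (A : Set (Finset α))) :
    IsUpperSet ((𝓒 ({i} : Finset α) {j} A : Finset (Finset α)) : Set (Finset α)) := by
  classical
  -- explicit description of the single-element compression
  have hc : ∀ x : Finset α, UV.compress ({i} : Finset α) {j} x = if i ∉ x ∧ j ∈ x then insert i (x.erase j) else x := by
    intro x
    have hcond : (Disjoint ({i} : Finset α) x ∧ ({j} : Finset α) ≤ x) ↔ (i ∉ x ∧ j ∈ x) := by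
      rw [Finset.disjoint_singleton_left, Finset.singleton_subset_iff]
    unfold UV.compress
    by_cases h : i ∉ x ∧ j ∈ x
    · rw [if_pos (hcond.2 h), if_pos h]
      ext y
      simp only [Finset.sup_eq_union, Finset.mem_sdiff, Finset.mem_union, Finset.mem_singleton, Finset.mem_insert,
        Finset.mem_erase]
      constructor
      · rintro ⟨h1 | h1, h2⟩
        · exact Or.inr ⟨h2, h1⟩
        · exact Or.inl h1
      · rintro (h1 | ⟨h1, h2⟩)
        · subst h1; exact ⟨Or.inr rfl, hij⟩
        · exact ⟨Or.inl h2, h1⟩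
    · rw [if_neg (fun h' => h (hcond.1 h')), if_neg h]
  intro a b hab ha
  rw [Finset.mem_coe, UV.mem_compression] at ha ⊢
  have hup : ∀ {x y : Finset α}, x ⊆ y → x ∈ A → y ∈ A := fun hxy hx => hA hxy hx
  rcases ha with ⟨haA, hcaA⟩ | ⟨haA, a₀, ha₀A, hca₀⟩
  · -- case 1: `a ∈ A` and `c a ∈ A`; then `b ∈ A` and we show `c b ∈ A`
    left
    refine ⟨hup hab haA, ?_⟩
    rw [hc b]
    by_cases hb : i ∉ b ∧ j ∈ b
    · rw [if_pos hb]
      by_cases hja : j ∈ a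
      · have hia : i ∉ a := fun h => hb.1 (hab h)
        have hca : UV.compress ({i} : Finset α) {j} a = insert i (a.erase j) := by rw [hc a, if_pos ⟨hia, hja⟩]
        rw [hca] at hcaA
        apply hup _ hcaA
        intro y hy
        rw [Finset.mem_insert, Finset.mem_erase] at hy ⊢
        rcases hy with h1 | ⟨h1, h2⟩
        · exact Or.inl h1
        · exact Or.inr ⟨h1, hab h2⟩
      · apply hup _ haA
        intro y hy
        rw [Finset.mem_insert, Finset.mem_erase]
        exact Or.inr ⟨fun h => hja (h ▸ hy), hab hy⟩
    · rw [if_neg hb]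
      exact hup hab haA
  · -- case 2: `a ∉ A`, `a = c a₀` with `a₀ ∈ A` (a genuine move: `j ∈ a₀`, `i ∉ a₀`, `a = a₀ − j + i`)
    have hmove : i ∉ a₀ ∧ j ∈ a₀ := by
      by_contra h
      rw [hc a₀, if_neg h] at hca₀
      exact haA (hca₀ ▸ ha₀A)
    have ha_eq : a = insert i (a₀.erase j) := by rw [← hca₀, hc a₀, if_pos hmove]
    have hia : i ∈ a := by rw [ha_eq]; exact Finset.mem_insert_self _ _
    have hib : i ∈ b := hab hia
    by_cases hbA : b ∈ A
    · left
      refine ⟨hbA, ?_⟩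
      rw [hc b, if_neg (fun h => h.1 hib)]
      exact hbA
    · right
      refine ⟨hbA, ?_⟩
      by_cases hjb : j ∈ b
      · -- then `b ⊇ a₀`, contradiction with `b ∉ A`
        exfalso
        apply hbA
        apply hup _ ha₀A
        intro y hy
        by_cases hyj : y = j
        · rw [hyj]; exact hjb
        · apply hab
          rw [ha_eq, Finset.mem_insert, Finset.mem_erase]
          exact Or.inr ⟨hyj, hy⟩
      · refine ⟨insert j (b.erase i), ?_, ?_⟩
        · apply hup _ ha₀A
          intro y hy
          rw [Finset.mem_insert, Finset.mem_erase]
          by_cases hyj : y = j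
          · exact Or.inl hyj
          · refine Or.inr ⟨fun hyi => hmove.1 (hyi ▸ hy), hab ?_⟩
            rw [ha_eq, Finset.mem_insert, Finset.mem_erase]
            exact Or.inr ⟨hyj, hy⟩
        · rw [hc, if_pos]
          · ext y
            simp only [Finset.mem_insert, Finset.mem_erase]
            constructor
            · rintro (h1 | ⟨h1, h2 | ⟨h3, h4⟩⟩)
              · exact h1 ▸ hib
              · exact absurd h2 h1
              · exact h4
            · intro hy
              by_cases hyi : y = i
              · exact Or.inl hyi
              · exact Or.inr ⟨fun hyj => hjb (hyj ▸ hy), Or.inr ⟨hyi, hy⟩⟩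
          · constructor
            · rw [Finset.mem_insert, Finset.mem_erase, not_or]
              exact ⟨hij, fun h => h.1 rfl⟩
            · exact Finset.mem_insert_self _ _

/-- The Kruskal–Katona measure `Σ_{s∈A} Σ_{a∈s} 2^a` strictly decreases under a genuine compression along `{i},{j}` with `i < j` (a left shift).
[Mathlib, `KruskalKatona.lean`, re-proved because the library lemma is private] -/
theorem measure_compression_lt {i j : Fin n} (hij : i < j) {A : Finset (Finset (Fin n))}
    (hne : 𝓒 ({i} : Finset (Fin n)) {j} A ≠ A) :
    ∑ s ∈ 𝓒 ({i} : Finset (Fin n)) {j} A, ∑ a ∈ s, 2 ^ (a : ℕ) < ∑ s ∈ A, ∑ a ∈ s, 2 ^ (a : ℕ) := by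
  classical
  have hmax : max' ({i} : Finset (Fin n)) (singleton_nonempty i) < max' ({j} : Finset (Fin n)) (singleton_nonempty j) := by
    rwa [max'_singleton, max'_singleton]
  rw [UV.compression] at hne ⊢
  have q : ∀ Q ∈ A.filter (fun s => UV.compress ({i} : Finset (Fin n)) {j} s ∉ A),
      UV.compress ({i} : Finset (Fin n)) {j} Q ≠ Q := by
    intro Q hQ h
    rw [mem_filter] at hQ
    apply hQ.2
    rw [h]
    exact hQ.1
  have uA : A.filter (fun s => UV.compress ({i} : Finset (Fin n)) {j} s ∈ A) ∪
      A.filter (fun s => UV.compress ({i} : Finset (Fin n)) {j} s ∉ A) = A := filter_union_filter_not_eq _ _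
  have ne₂ : (A.filter (fun s => UV.compress ({i} : Finset (Fin n)) {j} s ∉ A)).Nonempty := by
    rw [Finset.nonempty_iff_ne_empty]
    intro hemp
    apply hne
    rw [filter_image, hemp, image_empty, union_empty]
    conv_rhs => rw [← uA]
    rw [hemp, union_empty]
  rw [sum_union UV.compress_disjoint]
  conv_rhs => rw [← uA]
  rw [sum_union (disjoint_filter_filter_not _ _ _), add_lt_add_iff_left, filter_image, sum_image UV.compress_injOn]
  refine sum_lt_sum_of_nonempty ne₂ fun s hs => ?_
  simp_rw [← sum_image Fin.val_injective.injOn]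
  rw [geomSum_lt_geomSum_iff_toColex_lt_toColex le_rfl, Finset.Colex.toColex_image_lt_toColex_image Fin.val_strictMono]
  exact UV.toColex_compress_lt_toColex hmax (q _ hs)

/-- **(AB_l) on `Fin n` for all pairs of upper sets, from the determinant criterion on left-shifted upper sets.**  Suppose `1 ≤ l`, `2l ≤ n`, and that for every
upper set `A ⊆ 2^{Fin n}` that is left-shifted (compressed along `{i},{j}` for all `i < j`) the binomial matrix `[C(n−1−#(x∪x'), l−1)]_{x,x'∈A, #x<l}` has non-zero
determinant.  Then `#{s ∈ A ∩ Bᶜˢ | #s<l ∨ #sᶜ<l} ≤ #{s ∈ A ∩ B | #s<l ∨ #sᶜ<l}` for ALL upper sets `A, B`.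
Proof: strong induction on the Kruskal–Katona measure of `A`; if `A` is not left-shifted, compress `A` along `{i},{j}` and `B` along `{j},{i}` (gen-20 Lemma 1 does not increase
the functional, both stay upper, the measure of `A` drops); if it is, apply `AntiBandDetCriterion.antiBand_of_det_binomial_ne_zero`. [gen 21, memo §1(vi)] -/
theorem antiBand_of_forall_shifted_det_ne_zero (l : ℕ) (hl : 1 ≤ l) (h2l : 2 * l ≤ n)
    (hdet : ∀ A : Finset (Finset (Fin n)), IsUpperSet (A : Set (Finset (Fin n))) →
      (∀ i j : Fin n, i < j → UV.IsCompressed ({i} : Finset (Fin n)) {j} A) →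
      (Matrix.of fun (x x' : ↥(A.filter fun s => #s < l)) =>
        ((Fintype.card (Fin n) - 1 - #((x : Finset (Fin n)) ∪ x')).choose (l - 1) : ℤ)).det ≠ 0)
    (A B : Finset (Finset (Fin n))) (hA : IsUpperSet (A : Set (Finset (Fin n)))) (hB : IsUpperSet (B : Set (Finset (Fin n)))) :
    #((A ∩ Bᶜˢ).filter fun s => #s < l ∨ #sᶜ < l) ≤ #((A ∩ B).filter fun s => #s < l ∨ #sᶜ < l) := by
  classical
  -- strong induction on the measure of `A`
  suffices hmain : ∀ (m : ℕ) (A B : Finset (Finset (Fin n))), (∑ s ∈ A, ∑ a ∈ s, 2 ^ (a : ℕ)) = m →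
      IsUpperSet (A : Set (Finset (Fin n))) → IsUpperSet (B : Set (Finset (Fin n))) →
      #((A ∩ Bᶜˢ).filter fun s => #s < l ∨ #sᶜ < l) ≤ #((A ∩ B).filter fun s => #s < l ∨ #sᶜ < l) from
    hmain _ A B rfl hA hB
  intro m
  induction m using Nat.strong_induction_on with
  | _ m ih =>
    intro A B hm hA hB
    by_cases hsh : ∀ i j : Fin n, i < j → UV.IsCompressed ({i} : Finset (Fin n)) {j} A
    · -- left-shifted: the determinant criterion applies
      have hcard : 2 * l ≤ Fintype.card (Fin n) := by rw [Fintype.card_fin]; exact h2l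
      exact AntiBandDetCriterion.antiBand_of_det_binomial_ne_zero l hl A B hA hB hcard (hdet A hA hsh)
    · push Not at hsh
      obtain ⟨i, j, hij, hnc⟩ := hsh
      have hne : 𝓒 ({i} : Finset (Fin n)) {j} A ≠ A := hnc
      set A' := 𝓒 ({i} : Finset (Fin n)) {j} A with hA'
      set B' := 𝓒 ({j} : Finset (Fin n)) {i} B with hB'
      have hijne : i ≠ j := ne_of_lt hij
      have hA'up : IsUpperSet (A' : Set (Finset (Fin n))) := isUpperSet_compression_singleton hijne hA
      have hB'up : IsUpperSet (B' : Set (Finset (Fin n))) := isUpperSet_compression_singleton hijne.symm hB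
      have hlt : (∑ s ∈ A', ∑ a ∈ s, 2 ^ (a : ℕ)) < m := by rw [← hm]; exact measure_compression_lt hij hne
      have hrec := ih _ hlt A' B' rfl hA'up hB'up
      -- Lemma 1 (gen 20): the functional does not increase under the opposite compressions
      have hdisj : Disjoint ({i} : Finset (Fin n)) {j} := Finset.disjoint_singleton.2 hijne
      have hL := AntiBandShift.antiBand_compression_swap_le hdisj (by rw [card_singleton, card_singleton]) l A B
      have h1 : (0 : ℤ) ≤ (#((A' ∩ B').filter fun s => #s < l ∨ #sᶜ < l) : ℤ) - #((A' ∩ B'ᶜˢ).filter fun s => #s < l ∨ #sᶜ < l) := by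
        have := hrec; omega
      have h2 : (0 : ℤ) ≤ (#((A ∩ B).filter fun s => #s < l ∨ #sᶜ < l) : ℤ) - #((A ∩ Bᶜˢ).filter fun s => #s < l ∨ #sᶜ < l) :=
        h1.trans hL
      omega

end Summit.CriticalPhenomena.PercolationContinuityZ3.Theorems.AntiBandShiftReduction
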